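import Literature.NumberTheory.EllipticCurves.FunctionFieldBSDTateLemmaZ3Proofs
import Mathlib.Algebra.Module.CharacterModule
import Mathlib.RingTheory.Ideal.Operations
import HarnessLib

/-!
# `X/qX ≅ Hom(S[ψ], ℚ/ℤ)` for a Pontryagin-dual pair `X ≅ Hom(S, ℚ/ℤ)` in which `q` acts as the transpose of
# `ψ`, and the induced map `X/qX → Hom(B, ℚ/ℤ)` along `B → S[ψ]` (proofs file)

Topic `NumberTheory/EllipticCurves`, namespace `Literature.NumberTheory.EllipticCurves.PontryaginCard` (siblings:
`IwasawaEulerCharDualityProofs` — the case `q = T`, `ψ = γ − 1`: `IwasawaDual.IsDualPair.exists_coinvariants_addEquiv`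
«`X/TX ≅ Hom(S^Γ, ℚ/ℤ)`»; `FunctionFieldBSDTateLemmaZ3Proofs` — Tate's Lemma z.3 `TateBourbaki.natCard_ker_dual`).
THEOREMS ONLY (Mathlib's `CharacterModule`, `Submodule` quotients); no definition, no named fact, no instance, no
`sorry` (D-0014/D-0026).

SETTING. `R` a commutative ring, `X` an `R`-module, `S` an abelian group, `toDual : X →+ Hom(S, ℚ/ℤ)` a BIJECTIVE
additive map (a Pontryagin-dual pair, as in the tree's `WeierstrassCurve.SelmerDualData.toDual` for
`X = X(E/K_∞)`, `S = Sel_{p^∞}(E/K_∞)`), an element `q ∈ R` and an additive endomorphism `ψ` of `S` such that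
`q` acts on `X` as the TRANSPOSE of `ψ`: `toDual (q • x) s = toDual x (ψ s)`. (For `SelmerDualData` and Howard's
Eisenstein prime `q_m = T^m + p` this holds with `ψ_m = (conj_γ − 1)^m + p`, from `toDual_T_smul` / `toDual_C_smul`.)

* `exists_eq_smul_of_forall_ker` — a character `toDual x` killing `ker ψ` is `toDual (q • x')`: `x ∈ qX`;
* `exists_quotSMulTop_addEquiv_characterModule_ker` — **`X/qX ≃+ Hom(ker ψ, ℚ/ℤ)`** by restriction of characters
  (Greenberg: «`X/θ_n X` is the Pontryagin dual of `Sel_E(F_∞)_p^{Γ_n}`», LNM 1716 §4 p. 98, with `θ_n ↔ q`);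
* `exists_linearMap_quotSMulTop_characterModule` — for an `R`-module `B` and an additive `ι : B → S` landing in
  `ker ψ` and intertwining the `R`-actions through `toDual` (`toDual (r • x) (ι b) = toDual x (ι (r • b))`), the
  `R`-LINEAR map `h : X/qX → Hom(B, ℚ/ℤ)`, `h [x] = toDual x ∘ ι`, exists, with **`#ker h = #(ker ψ / ι(B))`** and
  `ker h` finite iff `ker ψ / ι(B)` is (Tate's Lemma z.3: the kernel of the dual of a map is the dual of its
  cokernel) — the shape of the fields `h`, `finite_ker`, `card_ker_le` of the tree's witness interface
  `HeegnerMuPartStabilized.SpecWitness` (file `Summits/…/Theorems/PrintX9MuPartSpecWitnessDefs`), whose intended `h`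
  is the dual of the comparison `H¹_{𝓕_𝔮}(K, A_𝔮) → H¹_{𝓕_Λ}(K, 𝐀)[𝔮]` of Howard 2004, Lemma 2.2.7 (arXiv 3.2.7).

Cell `pub/bsd-print-x9`, seat `bsd-line-x9-p1-w2` (g5), S1 dual-side bookkeeping for the shared μ-item of rows 9/10.

References: [GreenbergLNM1716] §4 p. 98 and §1 p. 60; [Howard2004HeegnerKolyvagin] Lemma 2.2.7, Prop. 2.2.8;
[Tate1966Bourbaki] §5 Lemma z.3.
-/

noncomputable section

open scoped Classical

universe u v w

namespace Literature.NumberTheory.EllipticCurves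

namespace PontryaginCard

variable {R : Type u} [CommRing R] {X : Type v} [AddCommGroup X] [Module R X] {S : Type w} [AddCommGroup S]

/-- **Injectivity modulo `q`**: in a dual pair `toDual : X ≅ Hom(S, ℚ/ℤ)` with `q` the transpose of `ψ`, a
character `toDual x` that kills `ker ψ` is of the form `toDual (q • x')`, i.e. `x ∈ qX` (descend `toDual x` to
`S/ker ψ ≅ ψ(S)` and extend to `S` by the injectivity of `ℚ/ℤ` — Tate's Lemma z.3, cokernel side,
`TateBourbaki.exact_dual_dual_kerSubtype` — then use the bijectivity of `toDual`).
[cite: GreenbergLNM1716, §4 p. 98] [cite: Tate1966Bourbaki, §5 Lemma z.3] -/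
theorem exists_eq_smul_of_forall_ker (toDual : X →+ CharacterModule S) (hbij : Function.Bijective toDual)
    (q : R) (ψ : S →+ S) (hq : ∀ (x : X) (s : S), toDual (q • x) s = toDual x (ψ s))
    {x : X} (hx : ∀ s : S, ψ s = 0 → toDual x s = 0) : ∃ x' : X, x = q • x' := by
  -- `toDual x` vanishes on `ker ψ`, hence is `χ ∘ ψ` for a character `χ` of `S`
  have hzero : CharacterModule.dual (R := ℤ) (LinearMap.ker ψ.toIntLinearMap).subtype (toDual x) = 0 := by
    refine CharacterModule.ext (A := ↥(LinearMap.ker ψ.toIntLinearMap)) fun s ↦ ?_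
    exact hx s.1 s.2
  obtain ⟨χ, hχ⟩ := ((TateBourbaki.exact_dual_dual_kerSubtype (R := ℤ) ψ.toIntLinearMap) (toDual x)).mp hzero
  -- `χ = toDual x'`, and `toDual (q • x') = χ ∘ ψ = toDual x`
  obtain ⟨x', rfl⟩ := hbij.2 χ
  refine ⟨x', hbij.1 ?_⟩
  refine CharacterModule.ext (A := S) fun s ↦ ?_
  rw [← hχ, hq]
  rfl

/-- **`X/qX ≅ Hom(S[ψ], ℚ/ℤ)`.** In a dual pair `toDual : X ≅ Hom(S, ℚ/ℤ)` with `q ∈ R` acting as the transpose of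
`ψ ∈ End(S)`, restriction of characters to `ker ψ` identifies `X/qX` with `Hom(ker ψ, ℚ/ℤ)`: restriction kills `qX`
(`toDual (q x) s = toDual x (ψ s) = 0` on `ker ψ`), is injective modulo `qX` (`exists_eq_smul_of_forall_ker`) and onto
(characters of `ker ψ ≤ S` extend, `ℚ/ℤ` being injective). The isomorphism `Ψ` satisfies `Ψ [x] a = toDual x a`.
Greenberg's «`X/θ_n X` is the Pontryagin dual of `Sel_E(F_∞)_p^{Γ_n}`» with `θ_n` replaced by any `q`.
[cite: GreenbergLNM1716, §4 p. 98 and §1 p. 60] -/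
theorem exists_quotSMulTop_addEquiv_characterModule_ker (toDual : X →+ CharacterModule S)
    (hbij : Function.Bijective toDual) (q : R) (ψ : S →+ S)
    (hq : ∀ (x : X) (s : S), toDual (q • x) s = toDual x (ψ s)) :
    ∃ Ψ : (X ⧸ ((Ideal.span {q} : Ideal R) • (⊤ : Submodule R X))) ≃+ CharacterModule ↥ψ.ker,
      ∀ (x : X) (a : ψ.ker), Ψ (Submodule.Quotient.mk x) a = toDual x a := by
  let R₀ : X →+ CharacterModule ↥ψ.ker :=
    { toFun := fun x ↦ (toDual x : S →+ AddCircle (1 : ℚ)).comp ψ.ker.subtype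
      map_zero' := by rw [map_zero]; rfl
      map_add' := fun x y ↦ by rw [map_add]; rfl }
  have hR₀ : ∀ (x : X) (a : ψ.ker), R₀ x a = toDual x a := fun _ _ ↦ rfl
  have hR₀q : ∀ x : X, R₀ (q • x) = 0 := fun x ↦ by
    refine CharacterModule.ext (A := ↥ψ.ker) fun a ↦ ?_
    rw [hR₀, hq, (AddMonoidHom.mem_ker).mp a.2, map_zero]
    rfl
  -- `R₀` kills `qX`
  have hker : ((Ideal.span {q} : Ideal R) • (⊤ : Submodule R X)).toAddSubgroup ≤ R₀.ker := by
    intro y hy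
    rw [Submodule.mem_toAddSubgroup, Submodule.ideal_span_singleton_smul] at hy
    obtain ⟨x, -, rfl⟩ := (Submodule.mem_smul_pointwise_iff_exists y q ⊤).1 hy
    exact (AddMonoidHom.mem_ker).mpr (hR₀q x)
  let Rq : (X ⧸ ((Ideal.span {q} : Ideal R) • (⊤ : Submodule R X))) →+ CharacterModule ↥ψ.ker :=
    QuotientAddGroup.lift _ R₀ hker
  have hRq : ∀ x : X, Rq (Submodule.Quotient.mk x) = R₀ x := fun _ ↦ rfl
  have hbijq : Function.Bijective Rq := by
    constructor
    · rw [injective_iff_map_eq_zero]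
      intro z hz
      induction z using Submodule.Quotient.induction_on with
      | H x =>
        rw [hRq] at hz
        have hx : ∀ s : S, ψ s = 0 → toDual x s = 0 := fun s hs ↦ by
          have := DFunLike.congr_fun hz ⟨s, (AddMonoidHom.mem_ker).mpr hs⟩
          rwa [hR₀] at this
        obtain ⟨y, rfl⟩ := exists_eq_smul_of_forall_ker toDual hbij q ψ hq hx
        rw [Submodule.Quotient.mk_eq_zero, Submodule.ideal_span_singleton_smul]
        exact Submodule.smul_mem_pointwise_smul y q ⊤ Submodule.mem_top
    · intro χ
      obtain ⟨χ', hχ'⟩ := CharacterModule.dual_surjective_of_injective (R := ℤ)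
        ψ.ker.subtype.toIntLinearMap (fun a b hab ↦ Subtype.ext hab) χ
      obtain ⟨x, hx⟩ := hbij.2 χ'
      refine ⟨Submodule.Quotient.mk x, ?_⟩
      rw [hRq]
      refine CharacterModule.ext (A := ↥ψ.ker) fun a ↦ ?_
      rw [hR₀, hx, ← hχ']
      rfl
  exact ⟨AddEquiv.ofBijective Rq hbijq, fun x a ↦ rfl⟩

/-- **The dual control map `h : X/qX → Hom(B, ℚ/ℤ)` along `ι : B → S[ψ]`, with `#ker h = #(S[ψ]/ι(B))`.** In the
setting of `exists_quotSMulTop_addEquiv_characterModule_ker`, let `B` be an `R`-module and `ι : B →+ S` an additive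
map landing in `ker ψ` and intertwining the `R`-actions through the pairing (`toDual (r • x) (ι b) = toDual x (ι (r • b))`).
Then there is an `R`-LINEAR `h : X/qX → Hom(B, ℚ/ℤ)` with `h [x] = toDual x ∘ ι`; its kernel is identified (through
`X/qX ≅ Hom(ker ψ, ℚ/ℤ)`) with the kernel of `Hom(ι', ℚ/ℤ)` for `ι' : B → ker ψ`, hence (Tate's Lemma z.3,
`TateBourbaki.natCard_ker_dual`) `#ker h = #(ker ψ / ι(B))` and `ker h` is finite iff `ker ψ / ι(B)` is. This is the
shape of the binders `h`, `finite_ker`, `card_ker_le` of `HeegnerMuPartStabilized.SpecWitness`: a discrete-side control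
map `H¹_{𝓕_𝔮}(K, A_𝔮) → H¹_{𝓕_Λ}(K, 𝐀)[𝔮]` with finite COKERNEL yields `h` with finite KERNEL of the same size.
[cite: Howard2004HeegnerKolyvagin, Lemma 2.2.7 and Prop. 2.2.8] [cite: Tate1966Bourbaki, §5 Lemma z.3]
[cite: GreenbergLNM1716, §4 p. 98] -/
theorem exists_linearMap_quotSMulTop_characterModule (toDual : X →+ CharacterModule S)
    (hbij : Function.Bijective toDual) (q : R) (ψ : S →+ S)
    (hq : ∀ (x : X) (s : S), toDual (q • x) s = toDual x (ψ s))
    {B : Type*} [AddCommGroup B] [Module R B] (ι : B →+ S) (hι : ∀ b : B, ψ (ι b) = 0)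
    (hιR : ∀ (r : R) (x : X) (b : B), toDual (r • x) (ι b) = toDual x (ι (r • b))) :
    ∃ h : (X ⧸ ((Ideal.span {q} : Ideal R) • (⊤ : Submodule R X))) →ₗ[R] CharacterModule B,
      (∀ (x : X) (b : B), h (Submodule.Quotient.mk x) b = toDual x (ι b)) ∧
      Nat.card (LinearMap.ker h) = Nat.card (ψ.ker ⧸ (ι.range).addSubgroupOf ψ.ker) ∧
      (Finite (LinearMap.ker h) ↔ Finite (ψ.ker ⧸ (ι.range).addSubgroupOf ψ.ker)) := by
  obtain ⟨Ψ, hΨ⟩ := exists_quotSMulTop_addEquiv_characterModule_ker toDual hbij q ψ hq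
  -- `ι' : B → ker ψ` and its dual `Hom(ker ψ, ℚ/ℤ) → Hom(B, ℚ/ℤ)`
  let ι' : B →+ ↥ψ.ker := ι.codRestrict ψ.ker fun b ↦ (AddMonoidHom.mem_ker).mpr (hι b)
  have hι' : ∀ b : B, ((ι' b : ψ.ker) : S) = ι b := fun _ ↦ rfl
  let dι := CharacterModule.dual (R := ℤ) ι'.toIntLinearMap
  have hdι : ∀ (χ : CharacterModule ↥ψ.ker) (b : B), dι χ b = χ (ι' b) := fun _ _ ↦ rfl
  -- the composite `X/qX → Hom(ker ψ, ℚ/ℤ) → Hom(B, ℚ/ℤ)` is `R`-linear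
  let h₀ : (X ⧸ ((Ideal.span {q} : Ideal R) • (⊤ : Submodule R X))) →+ CharacterModule B :=
    dι.toAddMonoidHom.comp Ψ.toAddMonoidHom
  have hh₀ : ∀ (x : X) (b : B), h₀ (Submodule.Quotient.mk x) b = toDual x (ι b) := fun x b ↦ by
    change dι (Ψ (Submodule.Quotient.mk x)) b = _
    rw [hdι, hΨ, hι']
  have hlin : ∀ (r : R) (z : X ⧸ ((Ideal.span {q} : Ideal R) • (⊤ : Submodule R X))),
      h₀ (r • z) = r • h₀ z := fun r z ↦ by
    induction z using Submodule.Quotient.induction_on with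
    | H x =>
      rw [← Submodule.Quotient.mk_smul]
      refine CharacterModule.ext (A := B) fun b ↦ ?_
      rw [hh₀, CharacterModule.smul_apply, hh₀, hιR]
  let h : (X ⧸ ((Ideal.span {q} : Ideal R) • (⊤ : Submodule R X))) →ₗ[R] CharacterModule B :=
    { toFun := h₀, map_add' := h₀.map_add, map_smul' := hlin }
  have hh : ∀ (x : X) (b : B), h (Submodule.Quotient.mk x) b = toDual x (ι b) := hh₀
  -- `coker ι' = ker ψ / ι(B)`
  have hrange : ι'.range = (ι.range).addSubgroupOf ψ.ker := by
    ext a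
    rw [AddMonoidHom.mem_range, AddSubgroup.mem_addSubgroupOf, AddMonoidHom.mem_range]
    constructor
    · rintro ⟨b, rfl⟩
      exact ⟨b, (hι' b).symm⟩
    · rintro ⟨b, hb⟩
      exact ⟨b, Subtype.ext (by rw [hι', hb])⟩
  have hrange' : (LinearMap.range ι'.toIntLinearMap).toAddSubgroup = (ι.range).addSubgroupOf ψ.ker := by
    rw [AddMonoidHom.coe_toIntLinearMap_range, AddSubgroup.toIntSubmodule_toAddSubgroup, hrange]
  have hcokerEquiv : (↥ψ.ker ⧸ LinearMap.range ι'.toIntLinearMap) ≃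
      (ψ.ker ⧸ (ι.range).addSubgroupOf ψ.ker) :=
    (QuotientAddGroup.quotientAddEquivOfEq hrange').toEquiv
  -- Tate z.3: `#ker Hom(ι', ℚ/ℤ) = #coker ι'`; `ker h ≃ ker Hom(ι', ℚ/ℤ)` through `Ψ`
  have hker : Nat.card (LinearMap.ker h) = Nat.card (↥ψ.ker ⧸ LinearMap.range ι'.toIntLinearMap) ∧
      (Finite (LinearMap.ker h) ↔ Finite (↥ψ.ker ⧸ LinearMap.range ι'.toIntLinearMap)) := by
    rw [← TateBourbaki.natCard_ker_dual (R := ℤ) ι'.toIntLinearMap,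
      ← TateBourbaki.finite_ker_dual_iff (R := ℤ) ι'.toIntLinearMap]
    refine ⟨Nat.card_congr ?e, Equiv.finite_iff ?e⟩
    exact
      { toFun := fun z ↦ ⟨Ψ z.1, by
          have hz : h z.1 = 0 := (LinearMap.mem_ker).mp z.2
          exact hz⟩
        invFun := fun χ ↦ ⟨Ψ.symm χ.1, by
          have hχ : dι χ.1 = 0 := χ.2
          rw [LinearMap.mem_ker]
          change dι (Ψ (Ψ.symm χ.1)) = 0
          rwa [AddEquiv.apply_symm_apply]⟩
        left_inv := fun z ↦ Subtype.ext (Ψ.symm_apply_apply z.1)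
        right_inv := fun χ ↦ Subtype.ext (Ψ.apply_symm_apply χ.1) }
  refine ⟨h, hh, ?_, ?_⟩
  · rw [hker.1, Nat.card_congr hcokerEquiv]
  · rw [hker.2, Equiv.finite_iff hcokerEquiv]

end PontryaginCard

end Literature.NumberTheory.EllipticCurves

end
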